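import Mathlib
import Summits.NavierStokesRegularity.NavierStokesRegularity.Theorems.StretchingWellBindingEnstrophyQuarterLawSparseSieveDefs
import Summits.NavierStokesRegularity.NavierStokesRegularity.Theorems.StretchingWellBindingEnstrophyQuarterLawFarFamilies
import Summits.NavierStokesRegularity.NavierStokesRegularity.Theorems.StretchingWellBindingEnstrophyQuarterLawEnstrophyScale
import Summits.NavierStokesRegularity.NavierStokesRegularity.Theorems.StretchingWellBindingEnstrophyQuarterLawSparsenessEarly
import HarnessLib

/-!
# Shelf crux `EnstrophyQuarterLaw` (stmt-NavierStokesRegularity-1574), line «sparse_sieve»: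
# the registered stub S2 `UniformSparseness T u` IS ITS CORE — near-field, fine-scale, late-time,
# above the enstrophy scale (unconditional equivalence along every first blow-up)

Helper file (`--supports stmt-NavierStokesRegularity-1574 --as helper`). For the OPEN registered stub
`stub_uniformSparseness` (predicate `UniformSparseness T u` of `…SparseSieveDefs`, p817378) this file proves, with
ONE absolute constant `c₀ > 0`, for every maximal classical solution `u` on `[0,T)` that is Leray–Hopf from a
rapidly decaying datum:

  `UniformSparseness T u ⟺ CORE(u)`,

where `CORE(u)` only counts the families that no landed theorem already bounds — for every radius `ρ` there are a
scale `r₁ > 0` and, per threshold `ε₀`, a bound `N₁` on `4r`-separated families of centres `x` with `‖x‖ < ρ`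
(NEAR FIELD), at scales `0 < r ≤ r₁` (FINE), times `t ∈ [T/2, T)` (LATE), and only when
`r · Z(t) > c₀ ε₀²` (ABOVE THE ENSTROPHY SCALE, `Z(t) = ∫ |curl u(t)|²`), whose balls `B(x,2r)` carry
`∫ |u(t)|³ ≥ ε₀³`. The complement is covered unconditionally by `SparsenessEarly.sparse_early_of_lerayHopf`
(early times, p814773), `FarFamilies.card_le_card_near_add` (far field at every scale, p818028) and
`EnstrophyScale.card_eq_zero_below_enstrophy_scale` (below the enstrophy scale, p817863).

READING (census currency): an exact, unconditional RESHAPING of S2 for the lead — the stub may be replaced by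
`CORE` without loss; with `SparsenessMacroscopic` (p816691) the scale window is moreover `c₀ε₀²/Z(t) < r < r_min`,
and by `SwarmTimes` (p818005) the violating times have measure `O(r)`. HONEST FRAMING: S2, the crux
`EnstrophyQuarterLaw` (1574) and Navier–Stokes regularity stay OPEN; no summit statement is proved.
-/

noncomputable section

-- the summit and its single sub-problem share the name (CONVENTIONS §1), as in every Theorems file
set_option linter.dupNamespace false

namespace Summit.NavierStokesRegularity.NavierStokesRegularity.Theorems.EnstrophyQuarterLaw.SparsenessCore

open MeasureTheory Set Metric
open Literature.Analysis Literature.Analysis.FluidPDE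
open Summit.NavierStokesRegularity.NavierStokesRegularity.Theorems.EnstrophyQuarterLaw.SparseSieve
open scoped ENNReal NNReal

/-- **`UniformSparseness ⟺ its near-field / fine-scale / late-time / high-enstrophy core`** (one absolute
`c₀`, every first blow-up). `→`: restriction. `←`: early times by `SparsenessEarly.sparse_early_of_lerayHopf`,
far centres (`‖x‖ ≥ ρ₁ + 2r`) by `FarFamilies.card_le_card_near_add`, sub-enstrophy scales
(`r Z(t) ≤ c₀ ε₀²`) by `EnstrophyScale.card_eq_zero_below_enstrophy_scale`, and the rest is the hypothesis at
radius `ρ = ρ₁ + 2` (scales capped at `1`). [folklore] -/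
theorem uniformSparseness_iff_core :
    ∃ c₀ : ℝ, 0 < c₀ ∧ ∀ (ν T : ℝ), 0 < ν → 0 < T →
      ∀ (u : ℝ → EuclideanSpace ℝ (Fin 3) → EuclideanSpace ℝ (Fin 3))
        (p : ℝ → EuclideanSpace ℝ (Fin 3) → ℝ),
      IsMaximalSmoothSolution ν 0 u p T → IsLerayHopfOn T ν 0 (u 0) u →
      HasRapidSpatialDecay (u 0) →
      (UniformSparseness T u ↔
        ∀ ρ : ℝ, 0 < ρ → ∃ r₁ : ℝ, 0 < r₁ ∧ ∀ ε₀ : ℝ, 0 < ε₀ → ∃ N₁ : ℕ,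
          ∀ t ∈ Set.Ico (T / 2) T, ∀ r ∈ Set.Ioc 0 r₁,
            c₀ * ε₀ ^ 2 < r * (∫⁻ y, ‖curl (u t) y‖ₑ ^ 2).toReal →
            ∀ F : Finset (EuclideanSpace ℝ (Fin 3)),
              (∀ x ∈ F, ∀ y ∈ F, x ≠ y → 4 * r ≤ dist x y) →
              (∀ x ∈ F, ENNReal.ofReal (ε₀ ^ 3) ≤ ∫⁻ y in Metric.ball x (2 * r), ‖u t y‖ₑ ^ 3) →
              (∀ x ∈ F, ‖x‖ < ρ) → F.card ≤ N₁) := by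
  classical
  obtain ⟨c₀, hc₀, hzero⟩ := EnstrophyScale.card_eq_zero_below_enstrophy_scale
  refine ⟨c₀, hc₀, fun ν T hν hT u p hmax hLH hdec => ⟨fun hS => ?_, fun hcore => ?_⟩⟩
  · -- `→`: restriction of the registered statement
    obtain ⟨r₀, hr₀, hN⟩ := hS
    intro ρ _hρ
    refine ⟨r₀, hr₀, fun ε₀ hε₀ => ?_⟩
    obtain ⟨N₀, hN₀⟩ := hN ε₀ hε₀
    exact ⟨N₀, fun t ht r hr _ F hsep hconc _ =>
      hN₀ t ⟨le_trans (by positivity) ht.1, ht.2⟩ r hr F hsep hconc⟩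
  · -- `←`: assemble the registered statement from the core and the three unconditional pieces
    have hsol : IsClassicalNSSolutionOn (Ico 0 T) ν 0 u p := hmax.1
    obtain ⟨ρ₁, hρ₁, hfar⟩ := FarFamilies.card_le_card_near_add hν hT hmax hLH hdec
    obtain ⟨r₁, hr₁, hN₁⟩ := hcore (ρ₁ + 2) (by positivity)
    have hT2 : T / 2 ∈ Ioo 0 T := ⟨by positivity, by linarith⟩
    have hearly := SparsenessEarly.sparse_early_of_lerayHopf hν hsol hLH hdec hT2
    refine ⟨min r₁ 1, by positivity, fun ε₀ hε₀ => ?_⟩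
    obtain ⟨Nf, hNf⟩ := hfar ε₀ hε₀
    obtain ⟨N₁, hN₁'⟩ := hN₁ ε₀ hε₀
    obtain ⟨Ne, hNe⟩ := hearly ε₀ hε₀
    refine ⟨Nf + N₁ + Ne, fun t ht r hr F hsep hconc => ?_⟩
    have hr1 : r ≤ r₁ := hr.2.trans (min_le_left _ _)
    have hr2 : r ≤ 1 := hr.2.trans (min_le_right _ _)
    by_cases hlate : T / 2 ≤ t
    · have htl : t ∈ Ico (T / 2) T := ⟨hlate, ht.2⟩
      by_cases hhigh : c₀ * ε₀ ^ 2 < r * (∫⁻ y, ‖curl (u t) y‖ₑ ^ 2).toReal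
      · -- late, above the enstrophy scale: far part + near core
        have h1 := hNf t htl r hr.1 F hsep hconc
        have h2 : (F.filter (fun x => ‖x‖ < ρ₁ + 2 * r)).card ≤ N₁ :=
          hN₁' t htl r ⟨hr.1, hr1⟩ hhigh (F.filter (fun x => ‖x‖ < ρ₁ + 2 * r))
            (fun x hx y hy hxy => hsep x (Finset.mem_filter.1 hx).1 y (Finset.mem_filter.1 hy).1 hxy)
            (fun x hx => hconc x (Finset.mem_filter.1 hx).1)
            (fun x hx => by
              have := (Finset.mem_filter.1 hx).2
              linarith)
        omega
      · -- below the enstrophy scale: no concentrating ball at all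
        have h0 := hzero ν T hν hT u p hmax hLH hdec ε₀ hε₀ t ht r hr.1 (not_lt.1 hhigh) F hconc
        omega
    · -- early times
      have h3 := hNe t ⟨ht.1, (not_le.1 hlate).le⟩ r hr.1 F hsep hconc
      omega

end Summit.NavierStokesRegularity.NavierStokesRegularity.Theorems.EnstrophyQuarterLaw.SparsenessCore

end
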